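import Literature.MathematicalPhysics.QuantumFieldTheory.Balaban1983to89.B9SectBGFrameV3
import Literature.MathematicalPhysics.QuantumFieldTheory.Balaban1983to89.B9Thm34HolderGClauseUniformBlk

/-!
# Balaban [B9] Thm 3.4 p. 400 × Thm 3.3 p. 399 × (3.43) p. 398 — THE (3.43) HÖLDER BLOCK-STEP OF SECT. B FOR THE BOND-SECTOR FAMILY G(U′U), INHABITED
# AT THE LETTERS, FRAME V3: `H1GFrame₃` (= `B9SectBH1GStepAtLetters.H1GFrame₂` re-typed to extend the BLOCK-CARRIER G frame `B9SectBGFrameV3.GFrame₃`) and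
# ★ `stepH1Pos_of_h1GFrame₃` — on r06's block-carrier Hölder G-clause `B9Thm34HolderGClauseUniformBlk.thm34_G_holder_clause_uniform_blk` (R-Ker-4 FILE 3)

T. Bałaban, *Propagators for lattice gauge theories in a background field*, Commun. Math. Phys. **99** (1985) 389–434
[`Balaban1985BackgroundPropagators`, "B9"]; [4] = T. Bałaban, *Propagators and renormalization transformations for lattice gauge
theories. II*, Commun. Math. Phys. **96** (1984) 223–250 [`Balaban1984PropagatorsII`].

statement-level skeleton of published theorems with citation tags; proofs where landed; nothing here is a claim about the
Yang–Mills mass gap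

WHY A V3 (LOCATED-10: the V2 C⁻¹ letters are scalar per block; r06's repair = the block-carrier clauses).  `B9SectBH1GStepAtLetters.H1GFrame₂` extends
`GFrame₂`; THIS FILE is the same one-field dictionary (`h1G_transfer`: the two PER-PROBE (3.43) statements of r06's kernel-free Hölder clause ⇒ the (3.43) block
of `GA` at U′U) extending `GFrame₃ … P GA Cinv`, and the step theorem's proof re-threaded on `thm34_G_holder_clause_uniform_blk` (the (3.48) input as the block
majorant `readKer` delivers; the section binders `blkP ∕ rep ∕ hrep ∕ hinj` of the frame; all else VERBATIM as V2).

HONEST SCOPE.  A hypothesis structure and one composition theorem; r06's theorems USED BY NAME; NOT shown inhabited here (instance for node00-def-Y's bond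
letters = the next units of dag-n06-c).  Count-neutral; NOT a node discharge; nothing continuum ∕ OS ∕ mass-gap ∕ Clay.  Seat dag-n06-c g12, 2026-08-28;
`--supports stmt-QuantumFields-27364`.
-/

noncomputable section

namespace Literature.MathematicalPhysics.QuantumFieldTheory.Balaban1983to89.B9SectBH1GFrameV3


open Literature.MathematicalPhysics.QuantumFieldTheory.Balaban1983to89
open Literature.MathematicalPhysics.QuantumFieldTheory.Balaban1983to89.B6RandomWalk (HasMajorant hasMajorant_mono Triangle254 Ineq261)
open Literature.MathematicalPhysics.QuantumFieldTheory.Balaban1983to89.B6RandomWalkHom (HasMajorantHom)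
open Literature.MathematicalPhysics.QuantumFieldTheory.Balaban1983to89.B6RandomWalkSection (secExt secRes secConj secConj_def
  secRes_comp_secExt)
open Literature.MathematicalPhysics.QuantumFieldTheory.Balaban1983to89.B9Thm34Ext (toB6)
open Literature.MathematicalPhysics.QuantumFieldTheory.Balaban1983to89.B9Ineq347 (ScaleTransfer)
open Literature.MathematicalPhysics.QuantumFieldTheory.Balaban1983to89.B9Eq39Adjoint (covD covDstar prodCfg plaqU)
open Literature.MathematicalPhysics.QuantumFieldTheory.Balaban1983to89.B9Eq369Small (Through)
open Literature.MathematicalPhysics.QuantumFieldTheory.Balaban1983to89.B9Eq372Locality (stBonds)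
open Literature.MathematicalPhysics.QuantumFieldTheory.Balaban1983to89.B9Eq352DivForm (tauF tauB)
open Literature.MathematicalPhysics.QuantumFieldTheory.Balaban1983to89.B9Eq352DivFormLetters (conj)
open Literature.MathematicalPhysics.QuantumFieldTheory.Balaban1983to89.B9Eq352GradLetters (diffLetter)
open Literature.MathematicalPhysics.QuantumFieldTheory.Balaban1983to89.B9Eq371GradLetters (bT bU)
open Literature.MathematicalPhysics.QuantumFieldTheory.Balaban1983to89.B9Eq372RemLetters (lapDDLetter)
open Literature.MathematicalPhysics.QuantumFieldTheory.Balaban1983to89.B9Eq382V3Letters (dPrimeLetter)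
open Literature.MathematicalPhysics.QuantumFieldTheory.Balaban1983to89.B9Eq376POneLetters (conjHom gradLin divLin)
open Literature.MathematicalPhysics.QuantumFieldTheory.Balaban1983to89.B9Eq386Neumann (pTwo deltaA)
open Literature.MathematicalPhysics.QuantumFieldTheory.Balaban1983to89.B9Eq360Vprime (gPrimeExtEnd pPrime pOp)
open Literature.MathematicalPhysics.QuantumFieldTheory.Balaban1983to89.B9Eq360VprimeLetters (vPrimeConc)
open Literature.MathematicalPhysics.QuantumFieldTheory.Balaban1983to89.B9Thm34SectBUniformR1 (thm34_Gp_uniform)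
open Literature.MathematicalPhysics.QuantumFieldTheory.Balaban1983to89.B6RandomWalkKernel (HasKernelBound hasKernelBound_mono)
open Literature.MathematicalPhysics.QuantumFieldTheory.Balaban1983to89.B9FromB6 (EBlock)
open Literature.MathematicalPhysics.QuantumFieldTheory.Balaban1983to89.B9SectBStepWhole (StepPos StepEPos)
open Literature.MathematicalPhysics.QuantumFieldTheory.Balaban1983to89.B9SectBGpStepAtLettersV2 (GpFrame₂)
open Literature.MathematicalPhysics.QuantumFieldTheory.Balaban1983to89.B9SectBGStepAtLetters (rZero_add_pPrime_sections)
open Literature.MathematicalPhysics.QuantumFieldTheory.Balaban1983to89.B6RandomWalk (BlockSupp)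
open Literature.MathematicalPhysics.QuantumFieldTheory.Balaban1983to89.B9Eq352DivFormLetters (coordEquiv)
open Literature.MathematicalPhysics.QuantumFieldTheory.Balaban1983to89.B9FromB6 (H1Block)
open Literature.MathematicalPhysics.QuantumFieldTheory.Balaban1983to89.B9SectBStepWhole (StepH1Pos)
open Literature.MathematicalPhysics.QuantumFieldTheory.Balaban1983to89.B9SectBGFrameV3 (GFrame₃)
open Literature.MathematicalPhysics.QuantumFieldTheory.Balaban1983to89.B9Thm34HolderGClauseUniformBlk (thm34_G_holder_clause_uniform_blk)

universe u

variable {I : Type} (c35 : ℝ) (geo : I → B9.Geometry) (bg : I → B9.Backgrounds)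
  (Gp : ∀ i, B9.KernelFamily (geo i) (bg i))
  {𝔸 : Type u} [NormedRing 𝔸] [NormedAlgebra ℂ 𝔸] [CompleteSpace 𝔸] {ι : Type} [Fintype ι] [DecidableEq ι]
  (b : Module.Basis ι ℝ 𝔸) (κ : Type) [Fintype κ] [LinearOrder κ]
  (S : I → Type) [∀ i, Fintype (S i)] [∀ i, DecidableEq (S i)]
  [∀ i, Fintype (geo i).Site] [∀ i, DecidableEq (geo i).Site] [∀ i, Nonempty (geo i).Site]
  (P : I → Type) [∀ i, Fintype (P i)] [∀ i, DecidableEq (P i)]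

/-- Rate bookkeeping for block majorants: a majorant `c·P(a)·e^{−δd}` with `c·P ≧ 0` stays one at any smaller rate `δ′ ≦ δ`
(d ≧ 0). [folklore] [cite: Balaban1984PropagatorsII, (2.51) p.232] -/
private theorem hasMajorant_rate_le {g : B6.Geometry} {X : Type} (blk : X → g.Site) {T : Module.End ℝ (X → ℝ)}
    {c δ δ' : ℝ} (P : g.Site → ℝ) (hc : ∀ a, 0 ≤ c * P a) (hδ : δ' ≤ δ) (hd : ∀ a a' : g.Site, 0 ≤ g.dist a a')
    (h : HasMajorant blk T (fun a a' => c * P a * Real.exp (-(δ * g.dist a a')))) :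
    HasMajorant blk T (fun a a' => c * P a * Real.exp (-(δ' * g.dist a a'))) :=
  hasMajorant_mono blk h fun a a' =>
    mul_le_mul_of_nonneg_left (Real.exp_le_exp.2 (by nlinarith [hd a a', hδ])) (hc a)

/-- **THE LETTERS DICTIONARY FOR THE HÖLDER BLOCK (3.43) OF THE BOND-SECTOR FAMILY G** — `GFrame₃` plus ONE transfer field: given the
(3.42) and (3.43) blocks of `GA` at U and the two PER-PROBE Hölder statements for the family's own `G(U′U)` at the call rate `δc`
(derivative on the left: for every left letter `D`, functional `Φ` of the bond function, anchor `y ∋ p₀`, exponent β, sizes `B_h, c_ζ ≧ 0`,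
the probe bound for `G(U)` implies the probe bound for `G(U′U)` with `B·B_h` at rate δc∕6; derivative on the right: for every right letter
`D_s` with a (3.42)₃-type entry, the probe bound for `G(U′U)D_s` from the three probe bounds (a) (b) (c) at U), the (3.43) block of `GA`
holds at U′U with (`wHG B δc B₀(·)`, `wHGδ δc`).  The probes are the instance's transported Hölder difference quotients (3.40) of bond
functions; field shape = the conclusions (iii)/(iv) of `B9Thm34HolderGClauseUniformR1.thm34_G_holder_clause_uniform` read for the letter
`Gb`.  A hypothesis structure; nothing asserted.
[cite: Balaban1985BackgroundPropagators, Thm 3.3 p.399 + (3.43) p.398 + (3.40) p.397 + Thm 3.4 p.400 + p.403 l.1–9 + (3.86) p.407; Balaban1984PropagatorsII, (2.51) p.232] -/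
structure H1GFrame₃ (GA : ∀ i, B9.KernelFamily (geo i) (bg i)) (Cinv : ∀ i, B9.SiteKernel (geo i) (bg i))
    extends GFrame₃ c35 geo bg Gp b κ S P GA Cinv where
  wHG : ℝ → ℝ → (ℝ → ℝ) → (ℝ → ℝ)
  wHGδ : ℝ → ℝ
  wHGδ_pos : ∀ δ : ℝ, 0 < δ → 0 < wHGδ δ
  /-- THE TRANSFER (at a call rate `δc ≦ δ`): the per-probe (3.43) statements (left transfer and right member, inputs at rate δc,
  outputs at δc∕6) for the family's `G(U′U)` ⇒ the (3.43) block of `GA` at U′U, given the (3.42) ∕ (3.43) blocks of `GA` at U at rate δ. -/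
  h1G_transfer : ∀ i (α₀ : ℝ) (U U' : (bg i).Cfg) (α₁ B₀ B δ δc : ℝ) (Bβ : ℝ → ℝ),
    MInv ≤ (geo i).M → 0 < α₀ → (geo i).M * α₀ ≤ aInv → (bg i).Reg335 c35 α₀ U →
    0 < α₁ → α₁ ≤ aW → (bg i).Cplx337 α₁ U U' → 0 < B₀ → 0 ≤ B → 0 < δ → 0 < δc → δc ≤ δ →
    EBlock (GA i) B₀ δ U → H1Block (GA i) Bβ δ U →
    -- the left transfer AT THE CALL RATE δc ≦ δ, for every probe
    (∀ (D : Module.End ℝ ((κ × S i) × ι → ℝ)) (Φ : (κ × S i → 𝔸) →ₗ[ℝ] 𝔸) (y : (geo i).Site) (p₀ : (κ × S i) × ι),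
      blk i p₀.1.2 = y →
      ∀ (β Bh cζ : ℝ), 0 ≤ Bh → 0 ≤ cζ →
        (∀ (y' : (geo i).Site) (μ : (κ × S i) × ι → ℝ) (M : ℝ),
          BlockSupp (g := toB6 (geo i) (Rr i) (Hp i)) (fun q : (κ × S i) × ι => blk i q.1.2) μ y' M →
          ‖Φ ((coordEquiv b).symm (D (Gb i U μ)))‖ ≤
            Bh * (geo i).len y ^ (1 - β) * cζ * Real.exp (-(δc * (geo i).dist y y')) * M) →
        ∀ (y' : (geo i).Site) (μ : (κ × S i) × ι → ℝ) (M : ℝ),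
          BlockSupp (g := toB6 (geo i) (Rr i) (Hp i)) (fun q : (κ × S i) × ι => blk i q.1.2) μ y' M →
          ‖Φ ((coordEquiv b).symm (D (Gb i ((bg i).mul U' U) μ)))‖ ≤
            B * Bh * (geo i).len y ^ (1 - β) * cζ * Real.exp (-(δc / 6 * (geo i).dist y y')) * M) →
    -- the right member AT THE CALL RATE δc, for every right letter with a (3.42)₃-type entry and every probe
    (∀ (Ds : Module.End ℝ ((κ × S i) × ι → ℝ)),
      HasMajorant (g := toB6 (geo i) (Rr i) (Hp i)) (fun q : (κ × S i) × ι => blk i q.1.2) (Gb i U * Ds)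
        (fun a a' => cRG * B₀ * (geo i).len a * Real.exp (-(δc * (geo i).dist a a'))) →
      ∀ (Φ : (κ × S i → 𝔸) →ₗ[ℝ] 𝔸) (y : (geo i).Site) (p₀ : (κ × S i) × ι), blk i p₀.1.2 = y →
      ∀ (γ Bh cζ : ℝ), 0 ≤ Bh → 0 ≤ cζ →
        (∀ (y' : (geo i).Site) (μ : (κ × S i) × ι → ℝ) (M : ℝ),
          BlockSupp (g := toB6 (geo i) (Rr i) (Hp i)) (fun q : (κ × S i) × ι => blk i q.1.2) μ y' M →
          ‖Φ ((coordEquiv b).symm (Gb i U μ))‖ ≤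
            Bh * (geo i).len y ^ (2 - γ) * cζ * Real.exp (-(δc * (geo i).dist y y')) * M) →
        (∀ (k : κ ⊕ κ) (y' : (geo i).Site) (μ : (κ × S i) × ι → ℝ) (M : ℝ),
          BlockSupp (g := toB6 (geo i) (Rr i) (Hp i)) (fun q : (κ × S i) × ι => blk i q.1.2) μ y' M →
          ‖Φ ((coordEquiv b).symm
              ((Gb i U * conj b (diffLetter (bT (T i)) (bU (coord i U)) ((((geo i).eta : ℂ))⁻¹) k)) μ))‖ ≤
            Bh * (geo i).len y ^ (1 - γ) * cζ * Real.exp (-(δc * (geo i).dist y y')) * M) →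
        (∀ (y' : (geo i).Site) (μ : (κ × S i) × ι → ℝ) (M : ℝ),
          BlockSupp (g := toB6 (geo i) (Rr i) (Hp i)) (fun q : (κ × S i) × ι => blk i q.1.2) μ y' M →
          ‖Φ ((coordEquiv b).symm ((Gb i U * Ds) μ))‖ ≤
            Bh * (geo i).len y ^ (1 - γ) * cζ * Real.exp (-(δc * (geo i).dist y y')) * M) →
        ∀ (y' : (geo i).Site) (μ : (κ × S i) × ι → ℝ) (M : ℝ),
          BlockSupp (g := toB6 (geo i) (Rr i) (Hp i)) (fun q : (κ × S i) × ι => blk i q.1.2) μ y' M →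
          ‖Φ ((coordEquiv b).symm ((Gb i ((bg i).mul U' U) * Ds) μ))‖ ≤
            B * Bh * (geo i).len y ^ (1 - γ) * cζ * Real.exp (-(δc / 6 * (geo i).dist y y')) * M) →
    H1Block (GA i) (wHG B δc Bβ) (wHGδ δc) ((bg i).mul U' U)

variable {c35 geo bg Gp b κ S P}

/-! ## ★ The (3.43)-step of Sect. B for G(U′U) at the letters -/

/-- ★ **THE (3.43)-STEP OF SECT. B FOR G(U′U), INHABITED AT THE LETTERS, KERNEL-FREE**: every `H1GFrame₃` with a Lemma-2.1 datum
`(d261, h261)` inhabits `B9SectBStepWhole.StepH1Pos F.dB c35 geo bg Gp GA Cinv GA` (outputs `wHG B δr B₀(·)`, `wHGδ δr`, `δr =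
min(min(δ₀,δ₁),δcap)` the call rate).  Proof: `B9Thm34HolderGClauseUniformR1.thm34_G_holder_clause_uniform` (constants `a₂, B` before
the member; NO kernel-form letter) and `thm34_Gp_uniform` (R1) for the inverse identities of the G′ extension, the three uniqueness
identifications of `B9SectBGStepAtLettersV2.entries342_ext_of_gFrame₃` (the family's G′(U′U), C⁻¹(U′U), G(U′U) ARE r06's), then the
frame's transfer field. [cite: Balaban1985BackgroundPropagators, Thm 3.4 p.400 + Thm 3.3 p.399 + (3.43) p.398 + (3.80)–(3.86) p.407 + (3.57)–(3.68) pp.402–403 + Thm 3.11 p.416; Balaban1984PropagatorsII, Lemma 2.1 (2.61) p.234] -/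
theorem stepH1Pos_of_h1GFrame₃ {GA : ∀ i, B9.KernelFamily (geo i) (bg i)} {Cinv : ∀ i, B9.SiteKernel (geo i) (bg i)}
    (F : H1GFrame₃ c35 geo bg Gp b κ S P GA Cinv) (d261 : ℝ → ℕ)
    (h261 : ∀ (i : I) (δ α : ℝ), 0 < δ → δ ≤ F.δcap → 9 / 5000 ≤ α → α < 1 → F.M261 δ ≤ (geo i).M →
      Ineq261 (d261 δ) (toB6 (geo i) (F.Rr i) (F.Hp i)) δ α) :
    StepH1Pos F.dB c35 geo bg Gp GA Cinv GA := by
  intro B₀ δ₀ Bβ Bε Bεβ B₁ δ₁ hB₀ hδ₀ hB₁ hδ₁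
  classical
  -- the common rate of the call
  have hδr : 0 < min (min δ₀ δ₁) F.δcap := lt_min (lt_min hδ₀ hδ₁) F.δcap_pos
  have hδr0 : min (min δ₀ δ₁) F.δcap ≤ δ₀ := le_trans (min_le_left _ _) (min_le_left _ _)
  have hδr1 : min (min δ₀ δ₁) F.δcap ≤ δ₁ := le_trans (min_le_left _ _) (min_le_right _ _)
  have hδrc : min (min δ₀ δ₁) F.δcap ≤ F.δcap := min_le_right _ _
  have hBG : 0 < F.cR * B₀ := mul_pos F.cR_pos hB₀
  have hBb : 0 < F.cRG * B₀ := mul_pos F.cRG_pos hB₀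
  have hBK : 0 < F.cK * B₁ := mul_pos F.cK_pos hB₁
  -- r06's uniform Theorem-3.4 clauses: G′ (for the inverse identities of the extension) and G
  obtain ⟨a₁, ha₁, B', -, H'⟩ := thm34_Gp_uniform b κ (d261 (min (min δ₀ δ₁) F.δcap)) (min (min δ₀ δ₁) F.δcap) (F.cR * B₀) F.Cq F.a₀ F.d₀ F.M₂
    (F.Λf (min (min δ₀ δ₁) F.δcap)) hBG F.Cq_nonneg F.a₀_nonneg F.M₂_nonneg hδr
    (fun α hα => F.Λf_one_le _ α hδr hα) F.hrepr
  obtain ⟨a₂, ha₂, B, hB, H⟩ := thm34_G_holder_clause_uniform_blk b κ (d261 (min (min δ₀ δ₁) F.δcap)) (min (min δ₀ δ₁) F.δcap) (F.cRG * B₀) F.κQ (F.cR * B₀)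
    (F.cK * B₁) F.cF F.Cq F.a₀ F.C₀ F.d₀ F.M₂ F.κQb F.cFb F.abar (F.Λf (min (min δ₀ δ₁) F.δcap)) hBb.le F.κQ_pos hBG hBK
    F.cF_pos F.Cq_nonneg F.a₀_nonneg F.C₀_nonneg F.M₂_nonneg hδr F.κQb_nonneg F.cFb_nonneg F.abar_nonneg
    (fun α hα => F.Λf_one_le _ α hδr hα) hBb F.hrepr
  refine ⟨F.Mthr (min (min δ₀ δ₁) F.δcap), min (min a₁ a₂) F.aW, F.aInv,
    (F.wHG B (min (min δ₀ δ₁) F.δcap) Bβ, F.wHGδ (min (min δ₀ δ₁) F.δcap)), F.Mthr_pos _, lt_min (lt_min ha₁ ha₂) F.aW_pos,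
    F.aInv_pos, F.wHGδ_pos _ hδr, ?_⟩
  intro i hM0 α₀ hα₀ hMa U hU hT α₁ hα₁ ha' U' hU'
  have ha : α₁ ≤ min a₁ a₂ := le_trans ha' (min_le_left _ _)
  have haW : α₁ ≤ F.aW := le_trans ha' (min_le_right _ _)
  have hEp : EBlock (Gp i) B₀ δ₀ U := hT.1.1.1
  have hKer := hT.2.1
  have hEG : EBlock (GA i) B₀ δ₀ U := hT.2.2.1.1
  have hH1 : H1Block (GA i) Bβ δ₀ U := hT.2.2.2.1
  have hM : F.MInv ≤ (geo i).M := F.MInv_le_of_Mthr_le hM0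
  have ha1 : α₁ ≤ a₁ := le_trans ha (min_le_left _ _)
  have ha2 : α₁ ≤ a₂ := le_trans ha (min_le_right _ _)
  -- the site-sector letters at U: G′(U) inverts Δ′_a(U); (3.42)₀,₁,₂ of G′ at δ₀ lowered to δr
  obtain ⟨hΔG, hGΔ⟩ := F.reg_inv i α₀ U hM hα₀ hMa hU
  obtain ⟨h1, h2, h3, -⟩ := F.read342 i α₀ U B₀ δ₀ hM hα₀ hMa hU hB₀ hδ₀ hEp
  have hc2 : ∀ a : (geo i).Site, 0 ≤ F.cR * B₀ * (geo i).len a ^ 2 := fun a => mul_nonneg hBG.le (sq_nonneg _)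
  have hc1 : ∀ a : (geo i).Site, 0 ≤ F.cR * B₀ * (geo i).len a := fun a => mul_nonneg hBG.le (F.len_pos i a).le
  have h1' := hasMajorant_rate_le (g := toB6 (geo i) (F.Rr i) (F.Hp i)) (fun p : S i × ι => F.blk i p.1)
    (fun a => (geo i).len a ^ 2) hc2 hδr0 (F.dist_nonneg i) h1
  have h2' := fun k => hasMajorant_rate_le (g := toB6 (geo i) (F.Rr i) (F.Hp i)) (fun p : S i × ι => F.blk i p.1)
    (fun a => (geo i).len a) hc1 hδr0 (F.dist_nonneg i) (h2 k)
  have h3' := fun k => hasMajorant_rate_le (g := toB6 (geo i) (F.Rr i) (F.Hp i)) (fun p : S i × ι => F.blk i p.1)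
    (fun a => (geo i).len a) hc1 hδr0 (F.dist_nonneg i) (h3 k)
  -- the (3.48) kernel of C⁻¹(U) at δ₁, read as a block majorant of the letter over the block carrier, lowered to δr
  have hK := F.readKer i α₀ U B₁ δ₁ hM hα₀ hMa hU hB₁ hδ₁ hKer
  have hK' : HasMajorant (g := toB6 (geo i) (F.Rr i) (F.Hp i)) (F.blkP i) (F.Cop i U)
      (fun a a' => F.cK * B₁ * (geo i).len a ^ (-(4 : ℝ)) * Real.exp (-(min (min δ₀ δ₁) F.δcap * (geo i).dist a a'))) := by
    refine hasMajorant_mono (g := toB6 (geo i) (F.Rr i) (F.Hp i)) (F.blkP i) hK fun a a' => ?_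
    refine mul_le_mul_of_nonneg_left (Real.exp_le_exp.2 ?_) ?_
    · nlinarith [F.dist_nonneg i a a', hδr1]
    · exact mul_nonneg hBK.le (Real.rpow_nonneg (F.len_pos i a).le _)
  -- the bond-sector letters at U: G(U) inverts Δ_a(U); (3.42) of G at δ₀ lowered to δr; (3.15) sizes at δr
  obtain ⟨hΔGb, hGbΔ⟩ := F.reg_ginv i α₀ U hM hα₀ hMa hU
  obtain ⟨g1, g2, g3, -⟩ := F.readG342 i α₀ U B₀ δ₀ hM hα₀ hMa hU hB₀ hδ₀ hEG
  have hb2 : ∀ a : (geo i).Site, 0 ≤ F.cRG * B₀ * (geo i).len a ^ 2 := fun a => mul_nonneg hBb.le (sq_nonneg _)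
  have hb1 : ∀ a : (geo i).Site, 0 ≤ F.cRG * B₀ * (geo i).len a := fun a => mul_nonneg hBb.le (F.len_pos i a).le
  have g1' := hasMajorant_rate_le (g := toB6 (geo i) (F.Rr i) (F.Hp i)) (fun q : (κ × S i) × ι => F.blk i q.1.2)
    (fun a => (geo i).len a ^ 2) hb2 hδr0 (F.dist_nonneg i) g1
  have g2' := fun k => hasMajorant_rate_le (g := toB6 (geo i) (F.Rr i) (F.Hp i)) (fun q : (κ × S i) × ι => F.blk i q.1.2)
    (fun a => (geo i).len a) hb1 hδr0 (F.dist_nonneg i) (g2 k)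
  have g3' := fun k => hasMajorant_rate_le (g := toB6 (geo i) (F.Rr i) (F.Hp i)) (fun q : (κ × S i) × ι => F.blk i q.1.2)
    (fun a => (geo i).len a) hb1 hδr0 (F.dist_nonneg i) (g3 k)
  have hQb := F.hQb i U _ hδr hδrc
  have hQsb := F.hQsb i U _ hδr hδrc
  -- the class (3.37) read blockwise; the (3.57), (3.80)–(3.81) letters; (3.35) on plaquettes
  obtain ⟨hkF, hsF, h337B, h337F, h337Bτ, hA, hAτB⟩ := F.cplx i α₁ U U' hα₁ hU'
  obtain ⟨h337B', h337FB, hAτF, hAFB, hAst, hAloc, hdAst⟩ := F.cplxG i α₁ U U' hα₁ hU'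
  obtain ⟨hQm, hQsm⟩ := F.q_mul i α₁ U U' hα₁ hU'
  obtain ⟨hFc, hFcs⟩ := F.hF i α₁ U U' hα₁ hU'
  obtain ⟨hQbm, hQsbm⟩ := F.qb_mul i α₁ U U' hα₁ hU'
  obtain ⟨hF₂, hF₂s⟩ := F.hF₂ i α₁ U U' hα₁ hU' _ hδr hδrc
  have h35 := F.reg335 i α₀ U hM hα₀ hMa hU
  -- the G′ clause: the inverse identities of the extension ⇒ the family's G′(U′U) is r06's extension
  obtain ⟨hinv1, hinv2, -, -⟩ := H' (F.T i) (F.coord i U) (F.blk i) (F.kQ i U) (F.sQ i U) (F.cfun i) (F.w i U)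
    (F.dist_nonneg i) (F.triangle i) (F.dist_self i) (F.dist_comm i) (F.len_pos i) (F.eta_le_len i) (F.eta_pos i)
    (fun α hα hα1 => h261 i _ α hδr hδrc hα hα1 (F.M261_le_of_Mthr_le hM0)) (F.hST_of i hδr hδrc hM0) (F.unitary i U)
    (F.stencilB i) (F.stencilF i) (F.stencil0 i) (F.w_nonneg i U) (F.card_w i U) (F.hkQ i U) (F.hsQ i U) (F.hcfun i)
    hΔG hGΔ h1' h2' h3' α₁ hα₁.le ha1 (F.expA i U U') (F.kF i U U') (F.sF i U U')
    hkF hsF h337B h337F h337Bτ hA hAτB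
  have hGp := F.gop_eq i ((bg i).mul U' U) _ _ (F.mul_law i α₁ U U' hα₁ hU') hinv1 hinv2
  -- the kernel-free G Hölder clause: identities + the two per-probe (3.43) transfers of r06's GExt
  obtain ⟨Tinv, GExt, hT1, hT2, hG1, hG2, -, -, hHL, hHR⟩ := H (F.T i) (F.coord i U) (F.blk i) (F.kQ i U) (F.sQ i U)
    (F.cfun i) (F.w i U)
    (F.dist_nonneg i) (F.triangle i) (F.dist_self i) (F.dist_comm i) (F.len_pos i) (F.eta_le_len i) (F.eta_pos i)
    (F.L_one_le i) (fun α hα hα1 => h261 i _ α hδr hδrc hα hα1 (F.M261_le_of_Mthr_le hM0)) (F.hST_of i hδr hδrc hM0) (F.T_comm i)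
    (F.unitary i U) h35 (F.stencilB i) (F.stencilF i) (F.stencilFB i) (F.stencilSt i) (F.stencilLoc i) (F.stencil0 i)
    (F.w_nonneg i U) (F.card_w i U) (F.hkQ i U) (F.hsQ i U) (F.hcfun i)
    h1' h2' h3' (F.blkP i) (F.rep i) (F.hrep i) (F.hinj i) (F.hQc i α₀ U hM hα₀ hMa hU) (F.hQcs i α₀ U hM hα₀ hMa hU)
    (F.reg_cinv i α₀ U hM hα₀ hMa hU) hK'
    hQb hQsb (F.ha324 i) hΔGb hGbΔ g1' g2' g3' α₁ hα₁.le ha2 (F.expA i U U') (F.kF i U U') (F.sF i U U')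
    hkF hsF h337B h337F h337B' h337Bτ h337FB hA hAτB hAτF hAFB hAst hAloc hdAst hQm hQsm hFc hFcs hQbm hQsbm rfl hF₂ hF₂s
  -- (1) G′(U′U) = r06's extension; (2) C⁻¹(U′U) = r06's Tinv
  rw [← hGp] at hT1 hT2 hG1 hG2
  have hC := F.cop_eq i ((bg i).mul U' U) _ Tinv rfl hT1 hT2
  rw [← hC] at hG1 hG2
  -- (3) the section identity: R₀ + P′(A) through `rep` is P(U′U) read directly; (4) the background of U′U
  rw [rZero_add_pPrime_sections (F.hinj i), ← F.coord_mul i α₁ U U' hα₁ hU'] at hG1 hG2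
  -- (5) G(U′U) = r06's GExt
  have hGb := F.gb_eq i ((bg i).mul U' U) _ GExt rfl hG1 hG2
  rw [← hGb] at hHL hHR
  exact F.h1G_transfer i α₀ U U' α₁ B₀ B δ₀ (min (min δ₀ δ₁) F.δcap) Bβ hM hα₀ hMa hU hα₁ haW hU' hB₀ hB hδ₀ hδr hδr0 hEG hH1
    hHL hHR

end Literature.MathematicalPhysics.QuantumFieldTheory.Balaban1983to89.B9SectBH1GFrameV3
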